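import Mathlib
import Literature.Analysis.Complex.SchwarzReflection
import Literature.Analysis.Complex.InjectiveHolomorphic

/-!
# The inverse uniformiser at a flat boundary stretch: reflection, injectivity, `w′ ≠ 0`,
# orientation (helper for `DensityIntegration`, item stmt-CriticalPhenomena-14890, route CardyBoundaryCoulombGas)

The engine crux `BoundaryDefectGaussianR` is consumed with a conformal map `w : D → ℍ` that is
analytic on a neighbourhood of the marks, with `Re (w ∘ ∂D)` strictly increasing there and the
factor `‖w′(x)‖`. For the inverse `w = φ⁻¹` of a uniformising map of a rectilinear polygon these
properties hold at every flat boundary point; this file proves the LOCAL complex-analysis package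
behind that (in standard position: the flat stretch on the real axis, the domain above it).
Let `U` be open and conjugation-symmetric, `f` continuous on `U ∩ {im ≥ 0}`, holomorphic on
`U ∩ {im > 0}`, real on `U ∩ ℝ`, with `im f > 0` on `U ∩ {im > 0}` and injective on `U ∩ {im ≥ 0}`.
Then the Schwarz reflection `F` of `f` is holomorphic (tree: `Complex.differentiableOn_schwarzReflection`)
and injective on `U`, `F′ ≠ 0` on `U` (tree: `SCV.deriv_ne_zero_of_injOn`), and at real points
`F′` is real and POSITIVE, so `Re f` is strictly increasing along real intervals of `U`.
-/

noncomputable section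

open Set Filter Topology Metric Complex
open scoped ComplexConjugate

namespace Summit.CriticalPhenomena.CardyFormulaZ2.Theorems

variable {f : ℂ → ℂ} {U : Set ℂ}

/-- Below the axis the reflection of a map with `im f > 0` above the axis has `im < 0`. [folklore] -/
theorem im_schwarzReflection_neg (hsymm : ∀ z ∈ U, conj z ∈ U)
    (hpos : ∀ z ∈ U, 0 < z.im → 0 < (f z).im) {z : ℂ} (hz : z ∈ U) (hzim : z.im < 0) :
    (Complex.schwarzReflection f z).im < 0 := by
  rw [Complex.im_schwarzReflection_of_neg hzim, neg_lt_zero]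
  exact hpos _ (hsymm z hz) (by simpa using hzim)

/-- On the closed upper half-plane the reflection has `im ≥ 0` (real on the axis, `im f > 0`
above). [folklore] -/
theorem im_schwarzReflection_nonneg (hreal : ∀ z ∈ U, z.im = 0 → (f z).im = 0)
    (hpos : ∀ z ∈ U, 0 < z.im → 0 < (f z).im) {z : ℂ} (hz : z ∈ U) (hzim : 0 ≤ z.im) :
    0 ≤ (Complex.schwarzReflection f z).im := by
  rw [Complex.schwarzReflection_of_nonneg hzim]
  rcases hzim.lt_or_eq with h | h
  · exact (hpos z hz h).le
  · exact (hreal z hz h.symm).ge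

/-- **Injectivity survives reflection**: if `f` is injective on `U ∩ {im ≥ 0}`, real on the axis
and maps `U ∩ {im > 0}` into `{im > 0}`, its Schwarz reflection is injective on `U`. [folklore] -/
theorem injOn_schwarzReflection (hsymm : ∀ z ∈ U, conj z ∈ U)
    (hreal : ∀ z ∈ U, z.im = 0 → (f z).im = 0) (hpos : ∀ z ∈ U, 0 < z.im → 0 < (f z).im)
    (hinj : InjOn f (U ∩ {z | 0 ≤ z.im})) : InjOn (Complex.schwarzReflection f) U := by
  intro z₁ hz₁ z₂ hz₂ heq
  by_cases h1 : 0 ≤ z₁.im <;> by_cases h2 : 0 ≤ z₂.im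
  · rw [Complex.schwarzReflection_of_nonneg h1, Complex.schwarzReflection_of_nonneg h2] at heq
    exact hinj ⟨hz₁, h1⟩ ⟨hz₂, h2⟩ heq
  · have ha := im_schwarzReflection_nonneg hreal hpos hz₁ h1
    have hb := im_schwarzReflection_neg hsymm hpos hz₂ (not_le.1 h2)
    rw [heq] at ha
    exact absurd hb (not_lt.2 ha)
  · have ha := im_schwarzReflection_neg hsymm hpos hz₁ (not_le.1 h1)
    have hb := im_schwarzReflection_nonneg hreal hpos hz₂ h2
    rw [heq] at ha
    exact absurd ha (not_lt.2 hb)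
  · rw [Complex.schwarzReflection_of_neg (not_le.1 h1),
      Complex.schwarzReflection_of_neg (not_le.1 h2)] at heq
    have heq' : f (conj z₁) = f (conj z₂) := star_injective heq
    have hm1 : conj z₁ ∈ U ∩ {z | 0 ≤ z.im} :=
      ⟨hsymm z₁ hz₁, by simp only [mem_setOf_eq, conj_im]; linarith [not_le.1 h1]⟩
    have hm2 : conj z₂ ∈ U ∩ {z | 0 ≤ z.im} :=
      ⟨hsymm z₂ hz₂, by simp only [mem_setOf_eq, conj_im]; linarith [not_le.1 h2]⟩
    exact star_injective (hinj hm1 hm2 heq')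

/-- **`F′ ≠ 0`** on `U` for the reflection `F` of an injective boundary-real map (injective
holomorphic maps have non-vanishing derivative, `SCV.deriv_ne_zero_of_injOn`). [folklore] -/
theorem deriv_schwarzReflection_ne_zero (hU : IsOpen U) (hsymm : ∀ z ∈ U, conj z ∈ U)
    (hc : ContinuousOn f (U ∩ {z | 0 ≤ z.im})) (hd : DifferentiableOn ℂ f (U ∩ {z | 0 < z.im}))
    (hreal : ∀ z ∈ U, z.im = 0 → (f z).im = 0) (hpos : ∀ z ∈ U, 0 < z.im → 0 < (f z).im)
    (hinj : InjOn f (U ∩ {z | 0 ≤ z.im})) {a : ℂ} (ha : a ∈ U) :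
    deriv (Complex.schwarzReflection f) a ≠ 0 :=
  Literature.Analysis.Complex.SCV.deriv_ne_zero_of_injOn
    (Complex.differentiableOn_schwarzReflection hU hsymm hc hd
      fun z hz hzim ↦ conj_eq_iff_im.2 (hreal z hz hzim))
    hU (injOn_schwarzReflection hsymm hreal hpos hinj) ha

/-- At a real point of `U` the derivative of the reflection is REAL (the reflection is real on
`U ∩ ℝ`). [folklore] -/
theorem im_deriv_schwarzReflection_ofReal (hU : IsOpen U) (hsymm : ∀ z ∈ U, conj z ∈ U)
    (hc : ContinuousOn f (U ∩ {z | 0 ≤ z.im})) (hd : DifferentiableOn ℂ f (U ∩ {z | 0 < z.im}))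
    (hreal : ∀ z ∈ U, z.im = 0 → (f z).im = 0) {x : ℝ} (hx : (x : ℂ) ∈ U) :
    (deriv (Complex.schwarzReflection f) x).im = 0 := by
  set F := Complex.schwarzReflection f with hF
  have hFd : DifferentiableOn ℂ F U := Complex.differentiableOn_schwarzReflection hU hsymm hc hd
    fun z hz hzim ↦ conj_eq_iff_im.2 (hreal z hz hzim)
  have hderiv : HasDerivAt F (deriv F x) x := (hFd.differentiableAt (hU.mem_nhds hx)).hasDerivAt
  -- the real function `t ↦ im F t = re (-I * F t)` has derivative `im F′(x)` ...
  have h1 : HasDerivAt (fun t : ℝ ↦ ((fun z ↦ -I * F z) t).re) (-I * deriv F x).re x :=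
    (hderiv.const_mul (-I)).real_of_complex
  have hre : ∀ w : ℂ, (-I * w).re = w.im := fun w ↦ by simp
  simp only [hre] at h1
  -- ... and is identically zero near `x`
  have hopen : IsOpen {t : ℝ | (t : ℂ) ∈ U} := hU.preimage continuous_ofReal
  have h0 : HasDerivAt (fun t : ℝ ↦ (F t).im) 0 x := by
    refine (hasDerivAt_const x (0 : ℝ)).congr_of_eventuallyEq ?_
    filter_upwards [hopen.mem_nhds hx] with t ht
    simp only [hF, Complex.schwarzReflection_ofReal]
    exact hreal _ ht (ofReal_im t)
  exact h1.unique h0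

/-- At a real point of `U` the derivative of the reflection has POSITIVE real part: it is real and
non-zero, and `im F(x + iy) / y > 0` for small `y > 0` forces `re F′(x) ≥ 0`. This is the
orientation statement: `f` maps the upper side to the upper side, so `Re f` increases along the
axis. [folklore] -/
theorem re_deriv_schwarzReflection_ofReal_pos (hU : IsOpen U) (hsymm : ∀ z ∈ U, conj z ∈ U)
    (hc : ContinuousOn f (U ∩ {z | 0 ≤ z.im})) (hd : DifferentiableOn ℂ f (U ∩ {z | 0 < z.im}))
    (hreal : ∀ z ∈ U, z.im = 0 → (f z).im = 0) (hpos : ∀ z ∈ U, 0 < z.im → 0 < (f z).im)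
    (hinj : InjOn f (U ∩ {z | 0 ≤ z.im})) {x : ℝ} (hx : (x : ℂ) ∈ U) :
    0 < (deriv (Complex.schwarzReflection f) x).re := by
  set F := Complex.schwarzReflection f with hF
  have hFd : DifferentiableOn ℂ F U := Complex.differentiableOn_schwarzReflection hU hsymm hc hd
    fun z hz hzim ↦ conj_eq_iff_im.2 (hreal z hz hzim)
  have hderiv : HasDerivAt F (deriv F x) x := (hFd.differentiableAt (hU.mem_nhds hx)).hasDerivAt
  have hne := deriv_schwarzReflection_ne_zero hU hsymm hc hd hreal hpos hinj hx
  have him := im_deriv_schwarzReflection_ofReal hU hsymm hc hd hreal hx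
  -- `re F′(x) ≥ 0` from the slopes in the direction `I`
  have hge : 0 ≤ (deriv F x).re := by
    have hslope := hderiv.tendsto_slope
    -- the path `y ↦ x + y I`, `y → 0⁺`
    have hpath : Tendsto (fun y : ℝ ↦ (x : ℂ) + y * I) (𝓝[>] 0) (𝓝[≠] (x : ℂ)) := by
      refine tendsto_nhdsWithin_iff.2 ⟨?_, ?_⟩
      · have : Continuous fun y : ℝ ↦ (x : ℂ) + y * I := by fun_prop
        simpa using (this.tendsto 0).mono_left nhdsWithin_le_nhds
      · filter_upwards [self_mem_nhdsWithin] with y hy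
        rw [mem_compl_iff, mem_singleton_iff]
        intro h
        have h' : (y : ℂ) * I = 0 := add_eq_left.1 h
        rcases mul_eq_zero.1 h' with h'' | h''
        · exact (ne_of_gt (show (0 : ℝ) < y from hy)) (ofReal_eq_zero.1 h'')
        · exact I_ne_zero h''
    have hlim := (continuous_re.tendsto _).comp (hslope.comp hpath)
    refine ge_of_tendsto hlim ?_
    -- eventually the slope has nonnegative real part
    have hmem : ∀ᶠ y : ℝ in nhdsWithin (0 : ℝ) (Ioi 0), ((x : ℂ) + (y : ℂ) * I) ∈ U := by
      have hcont : Continuous fun y : ℝ ↦ (x : ℂ) + (y : ℂ) * I := by fun_prop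
      have h : Tendsto (fun y : ℝ ↦ (x : ℂ) + (y : ℂ) * I) (𝓝 0) (𝓝 (x : ℂ)) := by
        simpa using hcont.tendsto 0
      exact (h.eventually (hU.mem_nhds hx)).filter_mono nhdsWithin_le_nhds
    filter_upwards [hmem, self_mem_nhdsWithin] with y hyU hy
    have hy0 : (0 : ℝ) < y := hy
    have hFx : F x = f x := by simp [hF]
    have hFy : F ((x : ℂ) + y * I) = f ((x : ℂ) + y * I) :=
      Complex.schwarzReflection_of_nonneg (by simp [hy0.le])
    have himy : 0 < (f ((x : ℂ) + y * I)).im := hpos _ hyU (by simp [hy0])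
    have hfx : (f x).im = 0 := hreal _ hx (ofReal_im x)
    simp only [Function.comp_apply, slope, vsub_eq_sub, hFx, hFy]
    rw [show (x : ℂ) + y * I - x = y * I by ring, smul_eq_mul,
      show ((y : ℂ) * I)⁻¹ = -I * (((y : ℝ)⁻¹ : ℝ) : ℂ) by
        rw [mul_inv, Complex.inv_I, Complex.ofReal_inv]; ring]
    have hw : ∀ w : ℂ, (-I * (((y : ℝ)⁻¹ : ℝ) : ℂ) * w).re = y⁻¹ * w.im := fun w ↦ by
      simp [Complex.mul_re, Complex.mul_im]
    rw [hw, Complex.sub_im, hfx, sub_zero]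
    positivity
  -- `re F′ ≠ 0` since `F′ ≠ 0` is real
  have hre_ne : (deriv F x).re ≠ 0 := by
    intro h0
    exact hne (Complex.ext h0 him)
  exact lt_of_le_of_ne hge (Ne.symm hre_ne)

/-- **Orientation along the flat stretch**: `Re f` is strictly increasing along every real
interval contained in `U` (derivative of `t ↦ Re F(t)` is `re F′(t) > 0`). This is the
`StrictMonoOn (fun t ↦ (w (D.boundary t)).re)` hypothesis of `BoundaryDefectGaussianR` in standard
position. [folklore] -/
theorem strictMonoOn_re_of_flat (hU : IsOpen U) (hsymm : ∀ z ∈ U, conj z ∈ U)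
    (hc : ContinuousOn f (U ∩ {z | 0 ≤ z.im})) (hd : DifferentiableOn ℂ f (U ∩ {z | 0 < z.im}))
    (hreal : ∀ z ∈ U, z.im = 0 → (f z).im = 0) (hpos : ∀ z ∈ U, 0 < z.im → 0 < (f z).im)
    (hinj : InjOn f (U ∩ {z | 0 ≤ z.im})) {D : Set ℝ} (hD : Convex ℝ D)
    (hDU : ∀ t ∈ D, (t : ℂ) ∈ U) : StrictMonoOn (fun t : ℝ ↦ (f t).re) D := by
  set F := Complex.schwarzReflection f with hF
  have hFd : DifferentiableOn ℂ F U := Complex.differentiableOn_schwarzReflection hU hsymm hc hd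
    fun z hz hzim ↦ conj_eq_iff_im.2 (hreal z hz hzim)
  have hderiv : ∀ t ∈ D, HasDerivAt (fun s : ℝ ↦ (F s).re) (deriv F t).re t := fun t ht ↦
    ((hFd.differentiableAt (hU.mem_nhds (hDU t ht))).hasDerivAt).real_of_complex
  have hcont : ContinuousOn (fun s : ℝ ↦ (F s).re) D := fun t ht ↦
    (hderiv t ht).continuousAt.continuousWithinAt
  have hmono : StrictMonoOn (fun s : ℝ ↦ (F s).re) D := by
    refine strictMonoOn_of_deriv_pos hD hcont fun t ht ↦ ?_
    rw [(hderiv t (interior_subset ht)).deriv]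
    exact re_deriv_schwarzReflection_ofReal_pos hU hsymm hc hd hreal hpos hinj
      (hDU t (interior_subset ht))
  intro a ha b hb hab
  have := hmono ha hb hab
  simpa [hF] using this

end Summit.CriticalPhenomena.CardyFormulaZ2.Theorems

end
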